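import Summits.AtomisticToContinuum.FouriersLaw.Theorems.BondHeatUncertaintySubdiffusiveBondHeatJunctionRatioTransferAtoms

/-!
# BondHeatUncertainty › SubdiffusiveBondHeat › JunctionRatio › TransferCalculus

Second file of the [LM] `TransferMoment` proof. The hot-end observable made explicit:
`Φ₁ = L ψ = genTransferHot` (any bath temperatures — `ψ` is linear in `p`, so the thermal part of `L`
kills it), its partial derivatives, `L Φ₁ = genGenTransferHot` (§E); the closed form
`Ψ_hot = transferObservableHot ω₂ λ β γ N` of `transferObservable ω₂ λ β γ T N 0 1`, which turns out NOT to
depend on `T` (`transferObservable_hot_eq`, §F); and the mirror identity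
`transferObservable … T N (N−1) (N−2) = Ψ_hot ∘ siteReflection N` (`transferObservable_cold_eq`, §G), from
`generator_comp_siteReflection` and the evenness of `V`. All [calculus].
-/

noncomputable section

open MeasureTheory Filter Topology Set
open scoped BigOperators

namespace Summit.AtomisticToContinuum.FouriersLaw.Theorems.SubdiffusiveBondHeat

namespace EscapeGrading

open Literature.MathematicalPhysics.KineticTheory.HeatConduction

variable {N : ℕ} {ω₂ lam β γ : ℝ}

/-! ## E. `Φ₁ = Lψ` explicitly, its partial derivatives, and `LΦ₁` -/

/-- `Φ₁ := Lψ_{01}` written out: `(p_1 − p_0) p_1 φ′(r) − (U′(q_1) + V′(r) − V′(s)) φ(r)`,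
`r = q_1 − q_0`, `s = q_2 − q_1`. -/
def genTransferHot (ω₂ lam β : ℝ) (N : ℕ) (hN : 3 ≤ N) (x : PhaseSpace N) : ℝ :=
  (x.2 (site1 hN) - x.2 (site0 hN)) * x.2 (site1 hN) * transferDPhi β (x.1 (site1 hN) - x.1 (site0 hN))
    - (pinForce ω₂ lam (x.1 (site1 hN)) + bondForce β (x.1 (site1 hN) - x.1 (site0 hN))
        - bondForce β (x.1 (site2 hN) - x.1 (site1 hN))) * transferPhi β (x.1 (site1 hN) - x.1 (site0 hN))

/-- `L ψ = genTransferHot` as functions (any bath temperatures: `ψ` is linear in `p`). [calculus] -/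
theorem generator_transferTest_hot_eq (hN : 3 ≤ N) (hβ : 0 ≤ β) (T_L T_R : ℝ) :
    (pinnedChain ω₂ lam β γ).generator N T_L T_R (transferTest β N (site0 hN) (site1 hN)) =
      genTransferHot ω₂ lam β N hN := by
  funext x
  rw [generator_transferTest_hot hN hβ, partialQ_hamiltonian_site1 hN]
  rfl

/-- `∂_{q_l} Φ₁`. [calculus] -/
theorem partialQ_genTransferHot (hN : 3 ≤ N) (hβ : 0 ≤ β) (l : Fin N) (x : PhaseSpace N) :
    partialQ l (genTransferHot ω₂ lam β N hN) x =
      ((x.2 (site1 hN) - x.2 (site0 hN)) * x.2 (site1 hN) * transferDDPhi β (x.1 (site1 hN) - x.1 (site0 hN))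
          - (pinForce ω₂ lam (x.1 (site1 hN)) + bondForce β (x.1 (site1 hN) - x.1 (site0 hN))
              - bondForce β (x.1 (site2 hN) - x.1 (site1 hN))) * transferDPhi β (x.1 (site1 hN) - x.1 (site0 hN))
          - bondStiff β (x.1 (site1 hN) - x.1 (site0 hN)) * transferPhi β (x.1 (site1 hN) - x.1 (site0 hN)))
        * ((if site1 hN = l then 1 else 0) - (if site0 hN = l then 1 else 0))
      - pinStiff ω₂ lam (x.1 (site1 hN)) * transferPhi β (x.1 (site1 hN) - x.1 (site0 hN))
        * (if site1 hN = l then 1 else 0)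
      + bondStiff β (x.1 (site2 hN) - x.1 (site1 hN)) * transferPhi β (x.1 (site1 hN) - x.1 (site0 hN))
        * ((if site2 hN = l then 1 else 0) - (if site1 hN = l then 1 else 0)) := by
  unfold partialQ
  have key : HasDerivAt (fun t => genTransferHot ω₂ lam β N hN (Function.update x.1 l t, x.2)) _ (x.1 l) :=
    ((hasDerivAt_comp_update_sub x.1 (site1 hN) (site0 hN) l (hasDerivAt_transferDPhi hβ _)).const_mul
      ((x.2 (site1 hN) - x.2 (site0 hN)) * x.2 (site1 hN))).fun_sub
      ((((hasDerivAt_comp_update_eval x.1 (site1 hN) l (hasDerivAt_pinForce ω₂ lam _)).fun_add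
        (hasDerivAt_comp_update_sub x.1 (site1 hN) (site0 hN) l (hasDerivAt_bondForce β _))).fun_sub
        (hasDerivAt_comp_update_sub x.1 (site2 hN) (site1 hN) l (hasDerivAt_bondForce β _))).fun_mul
        (hasDerivAt_comp_update_sub x.1 (site1 hN) (site0 hN) l (hasDerivAt_transferPhi hβ _)))
  refine key.deriv.trans ?_
  simp only [Function.update_eq_self]
  ring

/-- `∂_{p_l} Φ₁ = ((δ_{1l} − δ_{0l}) p_1 + (p_1 − p_0) δ_{1l}) φ′(r)`. [calculus] -/
theorem partialP_genTransferHot (hN : 3 ≤ N) (l : Fin N) (x : PhaseSpace N) :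
    partialP l (genTransferHot ω₂ lam β N hN) x =
      (((if site1 hN = l then 1 else 0) - (if site0 hN = l then 1 else 0)) * x.2 (site1 hN)
        + (x.2 (site1 hN) - x.2 (site0 hN)) * (if site1 hN = l then 1 else 0))
        * transferDPhi β (x.1 (site1 hN) - x.1 (site0 hN)) := by
  unfold partialP
  have key : HasDerivAt (fun t => genTransferHot ω₂ lam β N hN (x.1, Function.update x.2 l t)) _ (x.2 l) :=
    ((((hasDerivAt_update_eval x.2 l (site1 hN)).fun_sub (hasDerivAt_update_eval x.2 l (site0 hN))).fun_mul
      (hasDerivAt_update_eval x.2 l (site1 hN))).mul_const (transferDPhi β (x.1 (site1 hN) - x.1 (site0 hN)))).sub_const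
      ((pinForce ω₂ lam (x.1 (site1 hN)) + bondForce β (x.1 (site1 hN) - x.1 (site0 hN))
        - bondForce β (x.1 (site2 hN) - x.1 (site1 hN))) * transferPhi β (x.1 (site1 hN) - x.1 (site0 hN)))
  refine key.deriv.trans ?_
  simp only [Function.update_eq_self]

/-- `∂_{p_l} Φ₁` as a function (`partialP_genTransferHot` unapplied). [calculus] -/
theorem partialP_genTransferHot_fun (hN : 3 ≤ N) (l : Fin N) :
    partialP l (genTransferHot ω₂ lam β N hN) = fun x =>
      (((if site1 hN = l then 1 else 0) - (if site0 hN = l then 1 else 0)) * x.2 (site1 hN)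
        + (x.2 (site1 hN) - x.2 (site0 hN)) * (if site1 hN = l then 1 else 0))
        * transferDPhi β (x.1 (site1 hN) - x.1 (site0 hN)) :=
  funext (partialP_genTransferHot hN l)

/-- `∂²_{p_l} Φ₁ = 2 δ_{1l}(δ_{1l} − δ_{0l}) φ′(r)`. [calculus] -/
theorem partialP_partialP_genTransferHot (hN : 3 ≤ N) (l : Fin N) (x : PhaseSpace N) :
    partialP l (partialP l (genTransferHot ω₂ lam β N hN)) x =
      (((if site1 hN = l then 1 else 0) - (if site0 hN = l then 1 else 0)) * (if site1 hN = l then 1 else 0)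
        + ((if site1 hN = l then 1 else 0) - (if site0 hN = l then 1 else 0)) * (if site1 hN = l then 1 else 0))
        * transferDPhi β (x.1 (site1 hN) - x.1 (site0 hN)) := by
  rw [partialP_genTransferHot_fun]
  unfold partialP
  have key : HasDerivAt (fun t => (fun y : PhaseSpace N =>
      (((if site1 hN = l then 1 else 0) - (if site0 hN = l then 1 else 0)) * y.2 (site1 hN)
        + (y.2 (site1 hN) - y.2 (site0 hN)) * (if site1 hN = l then 1 else 0))
        * transferDPhi β (y.1 (site1 hN) - y.1 (site0 hN))) (x.1, Function.update x.2 l t)) _ (x.2 l) :=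
    (((hasDerivAt_update_eval x.2 l (site1 hN)).const_mul
        ((if site1 hN = l then (1 : ℝ) else 0) - (if site0 hN = l then (1 : ℝ) else 0))).fun_add
      (((hasDerivAt_update_eval x.2 l (site1 hN)).fun_sub (hasDerivAt_update_eval x.2 l (site0 hN))).mul_const
        (if site1 hN = l then (1 : ℝ) else 0))).mul_const (transferDPhi β (x.1 (site1 hN) - x.1 (site0 hN)))
  exact key.deriv

/-- **`LΦ₁` explicitly** (`N ≥ 3`; the only bath contribution is `γ p_0 p_1 φ′(r)` from site `0`). [calculus] -/
def genGenTransferHot (ω₂ lam β γ : ℝ) (N : ℕ) (hN : 3 ≤ N) (x : PhaseSpace N) : ℝ :=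
  (x.2 (site1 hN) - x.2 (site0 hN))
      * ((x.2 (site1 hN) - x.2 (site0 hN)) * x.2 (site1 hN) * transferDDPhi β (x.1 (site1 hN) - x.1 (site0 hN))
          - (pinForce ω₂ lam (x.1 (site1 hN)) + bondForce β (x.1 (site1 hN) - x.1 (site0 hN))
              - bondForce β (x.1 (site2 hN) - x.1 (site1 hN))) * transferDPhi β (x.1 (site1 hN) - x.1 (site0 hN))
          - bondStiff β (x.1 (site1 hN) - x.1 (site0 hN)) * transferPhi β (x.1 (site1 hN) - x.1 (site0 hN)))
    - pinStiff ω₂ lam (x.1 (site1 hN)) * transferPhi β (x.1 (site1 hN) - x.1 (site0 hN)) * x.2 (site1 hN)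
    + bondStiff β (x.1 (site2 hN) - x.1 (site1 hN)) * transferPhi β (x.1 (site1 hN) - x.1 (site0 hN))
        * (x.2 (site2 hN) - x.2 (site1 hN))
    - transferDPhi β (x.1 (site1 hN) - x.1 (site0 hN))
        * (((pinForce ω₂ lam (x.1 (site1 hN)) + bondForce β (x.1 (site1 hN) - x.1 (site0 hN))
              - bondForce β (x.1 (site2 hN) - x.1 (site1 hN)))
              - (pinForce ω₂ lam (x.1 (site0 hN)) - bondForce β (x.1 (site1 hN) - x.1 (site0 hN))))
            * x.2 (site1 hN)
          + (x.2 (site1 hN) - x.2 (site0 hN))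
            * (pinForce ω₂ lam (x.1 (site1 hN)) + bondForce β (x.1 (site1 hN) - x.1 (site0 hN))
              - bondForce β (x.1 (site2 hN) - x.1 (site1 hN))))
    + γ * x.2 (site0 hN) * x.2 (site1 hN) * transferDPhi β (x.1 (site1 hN) - x.1 (site0 hN))

/-- `L Φ₁ = genGenTransferHot` (any bath temperatures: `Φ₁` is affine in `p_0` and free of `p_{N−1}`). [calculus] -/
theorem generator_genTransferHot (hN : 3 ≤ N) (hβ : 0 ≤ β) (T_L T_R : ℝ) (x : PhaseSpace N) :
    (pinnedChain ω₂ lam β γ).generator N T_L T_R (genTransferHot ω₂ lam β N hN) x =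
      genGenTransferHot ω₂ lam β γ N hN x := by
  have h01 := site0_ne_site1 hN
  have h02 := site0_ne_site2 hN
  have h12 := site1_ne_site2 hN
  unfold OscillatorChain.generator genGenTransferHot
  have hA : ∑ l : Fin N, (x.2 l * partialQ l (genTransferHot ω₂ lam β N hN) x
      - partialQ l ((pinnedChain ω₂ lam β γ).hamiltonian N) x * partialP l (genTransferHot ω₂ lam β N hN) x)
      = (x.2 (site1 hN) - x.2 (site0 hN))
          * ((x.2 (site1 hN) - x.2 (site0 hN)) * x.2 (site1 hN) * transferDDPhi β (x.1 (site1 hN) - x.1 (site0 hN))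
            - (pinForce ω₂ lam (x.1 (site1 hN)) + bondForce β (x.1 (site1 hN) - x.1 (site0 hN))
                - bondForce β (x.1 (site2 hN) - x.1 (site1 hN))) * transferDPhi β (x.1 (site1 hN) - x.1 (site0 hN))
            - bondStiff β (x.1 (site1 hN) - x.1 (site0 hN)) * transferPhi β (x.1 (site1 hN) - x.1 (site0 hN)))
        - pinStiff ω₂ lam (x.1 (site1 hN)) * transferPhi β (x.1 (site1 hN) - x.1 (site0 hN)) * x.2 (site1 hN)
        + bondStiff β (x.1 (site2 hN) - x.1 (site1 hN)) * transferPhi β (x.1 (site1 hN) - x.1 (site0 hN))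
            * (x.2 (site2 hN) - x.2 (site1 hN))
        - transferDPhi β (x.1 (site1 hN) - x.1 (site0 hN))
            * ((partialQ (site1 hN) ((pinnedChain ω₂ lam β γ).hamiltonian N) x
                  - partialQ (site0 hN) ((pinnedChain ω₂ lam β γ).hamiltonian N) x) * x.2 (site1 hN)
              + (x.2 (site1 hN) - x.2 (site0 hN))
                * partialQ (site1 hN) ((pinnedChain ω₂ lam β γ).hamiltonian N) x) := by
    have e : ∀ l : Fin N, (x.2 l * partialQ l (genTransferHot ω₂ lam β N hN) x
        - partialQ l ((pinnedChain ω₂ lam β γ).hamiltonian N) x * partialP l (genTransferHot ω₂ lam β N hN) x)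
        = (if site1 hN = l then
            x.2 (site1 hN)
              * ((x.2 (site1 hN) - x.2 (site0 hN)) * x.2 (site1 hN) * transferDDPhi β (x.1 (site1 hN) - x.1 (site0 hN))
                - (pinForce ω₂ lam (x.1 (site1 hN)) + bondForce β (x.1 (site1 hN) - x.1 (site0 hN))
                    - bondForce β (x.1 (site2 hN) - x.1 (site1 hN))) * transferDPhi β (x.1 (site1 hN) - x.1 (site0 hN))
                - bondStiff β (x.1 (site1 hN) - x.1 (site0 hN)) * transferPhi β (x.1 (site1 hN) - x.1 (site0 hN))
                - pinStiff ω₂ lam (x.1 (site1 hN)) * transferPhi β (x.1 (site1 hN) - x.1 (site0 hN))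
                - bondStiff β (x.1 (site2 hN) - x.1 (site1 hN)) * transferPhi β (x.1 (site1 hN) - x.1 (site0 hN)))
            - partialQ (site1 hN) ((pinnedChain ω₂ lam β γ).hamiltonian N) x
              * ((2 * x.2 (site1 hN) - x.2 (site0 hN)) * transferDPhi β (x.1 (site1 hN) - x.1 (site0 hN))) else 0)
          + (if site0 hN = l then
            -(x.2 (site0 hN)
              * ((x.2 (site1 hN) - x.2 (site0 hN)) * x.2 (site1 hN) * transferDDPhi β (x.1 (site1 hN) - x.1 (site0 hN))
                - (pinForce ω₂ lam (x.1 (site1 hN)) + bondForce β (x.1 (site1 hN) - x.1 (site0 hN))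
                    - bondForce β (x.1 (site2 hN) - x.1 (site1 hN))) * transferDPhi β (x.1 (site1 hN) - x.1 (site0 hN))
                - bondStiff β (x.1 (site1 hN) - x.1 (site0 hN)) * transferPhi β (x.1 (site1 hN) - x.1 (site0 hN))))
            + partialQ (site0 hN) ((pinnedChain ω₂ lam β γ).hamiltonian N) x
              * (x.2 (site1 hN) * transferDPhi β (x.1 (site1 hN) - x.1 (site0 hN))) else 0)
          + (if site2 hN = l then
            x.2 (site2 hN) * (bondStiff β (x.1 (site2 hN) - x.1 (site1 hN))
              * transferPhi β (x.1 (site1 hN) - x.1 (site0 hN))) else 0) := by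
      intro l
      rw [partialQ_genTransferHot hN hβ, partialP_genTransferHot hN]
      by_cases h1 : site1 hN = l
      · subst h1
        simp [h01, h12.symm]
        ring
      · by_cases h0 : site0 hN = l
        · subst h0
          simp [h1, h02.symm]
          ring
        · by_cases h2 : site2 hN = l
          · subst h2
            simp [h0, h1]
          · simp [h0, h1, h2]
    rw [Finset.sum_congr rfl fun l _ => e l, Finset.sum_add_distrib, Finset.sum_add_distrib, Finset.sum_ite_eq,
      Finset.sum_ite_eq, Finset.sum_ite_eq]
    simp only [Finset.mem_univ, if_true]
    ring
  have hB : ∑ l : Fin N, ((if l.val = 0 then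
        T_L * partialP l (partialP l (genTransferHot ω₂ lam β N hN)) x
          - x.2 l * partialP l (genTransferHot ω₂ lam β N hN) x else 0)
      + (if l.val = N - 1 then
        T_R * partialP l (partialP l (genTransferHot ω₂ lam β N hN)) x
          - x.2 l * partialP l (genTransferHot ω₂ lam β N hN) x else 0))
      = x.2 (site0 hN) * x.2 (site1 hN) * transferDPhi β (x.1 (site1 hN) - x.1 (site0 hN)) := by
    have e : ∀ l : Fin N, ((if l.val = 0 then
        T_L * partialP l (partialP l (genTransferHot ω₂ lam β N hN)) x
          - x.2 l * partialP l (genTransferHot ω₂ lam β N hN) x else 0)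
      + (if l.val = N - 1 then
        T_R * partialP l (partialP l (genTransferHot ω₂ lam β N hN)) x
          - x.2 l * partialP l (genTransferHot ω₂ lam β N hN) x else 0))
        = if site0 hN = l then x.2 (site0 hN) * x.2 (site1 hN) * transferDPhi β (x.1 (site1 hN) - x.1 (site0 hN)) else 0 := by
      intro l
      rw [partialP_partialP_genTransferHot hN, partialP_genTransferHot hN]
      by_cases h0 : site0 hN = l
      · subst h0
        have hz : (site0 hN).val ≠ N - 1 := by simp; omega
        simp [h01.symm, hz]
        ring
      · have hl0 : l.val ≠ 0 := fun h => h0 (Fin.ext (by simp [h]))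
        by_cases hlz : l.val = N - 1
        · have h1l : site1 hN ≠ l := fun h => by rw [← h] at hlz; simp at hlz; omega
          simp [h0, hl0, h1l]
        · simp [h0, hl0, hlz]
    rw [Finset.sum_congr rfl fun l _ => e l, Finset.sum_ite_eq]
    simp
  rw [hA, hB, partialQ_hamiltonian_site1 hN, partialQ_hamiltonian_site0 hN, pinnedChain_γ]
  ring

/-! ## F. The transfer observable `Ψ` at the hot end, explicitly -/

/-- **Explicit `Ψ_hot`.** `Ψ = LΦ₁ − γΦ₁ + (U″(q_0) + V″(r)) ψ` written as a rational function of
`(q_0, q_1, q_2, p_0, p_1, p_2)`. -/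
def transferObservableHot (ω₂ lam β γ : ℝ) (N : ℕ) (hN : 3 ≤ N) (x : PhaseSpace N) : ℝ :=
  genGenTransferHot ω₂ lam β γ N hN x - γ * genTransferHot ω₂ lam β N hN x
    + (pinStiff ω₂ lam (x.1 (site0 hN)) + bondStiff β (x.1 (site1 hN) - x.1 (site0 hN)))
      * (x.2 (site1 hN) * transferPhi β (x.1 (site1 hN) - x.1 (site0 hN)))

/-- `Ψ_{T}(0, 1) = Ψ_hot` for every `T` (the second-order test observable does not see the bath
temperature). [calculus] -/
theorem transferObservable_hot_eq (hN : 3 ≤ N) (hβ : 0 ≤ β) (T : ℝ) (x : PhaseSpace N) :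
    transferObservable ω₂ lam β γ T N ⟨0, by omega⟩ ⟨1, by omega⟩ x =
      transferObservableHot ω₂ lam β γ N hN x := by
  show transferObservable ω₂ lam β γ T N (site0 hN) (site1 hN) x = _
  unfold transferObservable transferObservableHot
  rw [generator_transferTest_hot_eq hN hβ, generator_genTransferHot hN hβ]
  have eψ : transferTest β N (site0 hN) (site1 hN) x
      = x.2 (site1 hN) * transferPhi β (x.1 (site1 hN) - x.1 (site0 hN)) := by
    rw [transferTest_eq]
  rw [eψ]
  rfl

/-! ## G. The cold end is the mirror image of the hot end -/

/-- `ψ_{ij} ∘ R = ψ_{rev i, rev j}`. -/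
theorem transferTest_comp_siteReflection (β : ℝ) (N : ℕ) (i j : Fin N) :
    transferTest β N i j ∘ siteReflection N = transferTest β N (Fin.rev i) (Fin.rev j) := by
  funext x
  simp [transferTest, Function.comp]

/-- `L ψ_{rev i, rev j} = (L ψ_{ij}) ∘ R` at equal bath temperatures. -/
theorem generator_transferTest_rev (ω₂ lam β γ T : ℝ) (N : ℕ) (i j : Fin N) :
    (pinnedChain ω₂ lam β γ).generator N T T (transferTest β N (Fin.rev i) (Fin.rev j)) =
      (pinnedChain ω₂ lam β γ).generator N T T (transferTest β N i j) ∘ siteReflection N := by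
  funext x
  rw [← transferTest_comp_siteReflection]
  exact (pinnedChain ω₂ lam β γ).generator_comp_siteReflection (pinnedChain_V_neg ω₂ lam β γ) N T T _ x

/-- **Mirror symmetry of the transfer observable**: `Ψ_T(rev i, rev j)(x) = Ψ_T(i, j)(R x)`. -/
theorem transferObservable_rev (ω₂ lam β γ T : ℝ) (N : ℕ) (i j : Fin N) (x : PhaseSpace N) :
    transferObservable ω₂ lam β γ T N (Fin.rev i) (Fin.rev j) x =
      transferObservable ω₂ lam β γ T N i j (siteReflection N x) := by
  unfold transferObservable
  rw [generator_transferTest_rev,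
    (pinnedChain ω₂ lam β γ).generator_comp_siteReflection (pinnedChain_V_neg ω₂ lam β γ) N T T _ x]
  have eψ : transferTest β N (Fin.rev i) (Fin.rev j) x = transferTest β N i j (siteReflection N x) := by
    rw [← transferTest_comp_siteReflection]; rfl
  rw [eψ]
  simp only [Function.comp_apply, siteReflection_fst]

/-- The cold-end pair `(N−1, N−2)` is the mirror image of `(0, 1)`. -/
theorem last_eq_rev_site0 (hN : 3 ≤ N) : (⟨N - 1, by omega⟩ : Fin N) = Fin.rev (site0 hN) :=
  Fin.ext (by simp [Fin.val_rev])

/-- `N − 2 = rev 1` in `Fin N`. [bookkeeping] -/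
theorem lastButOne_eq_rev_site1 (hN : 3 ≤ N) : (⟨N - 1 - 1, by omega⟩ : Fin N) = Fin.rev (site1 hN) :=
  Fin.ext (by simp [Fin.val_rev]; omega)

/-- **`Ψ_cold = Ψ_hot ∘ R`.** -/
theorem transferObservable_cold_eq (hN : 3 ≤ N) (hβ : 0 ≤ β) (T : ℝ) (x : PhaseSpace N) :
    transferObservable ω₂ lam β γ T N ⟨N - 1, by omega⟩ ⟨N - 1 - 1, by omega⟩ x =
      transferObservableHot ω₂ lam β γ N hN (siteReflection N x) := by
  rw [last_eq_rev_site0 hN, lastButOne_eq_rev_site1 hN, transferObservable_rev,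
    ← transferObservable_hot_eq hN hβ T]

end EscapeGrading

end Summit.AtomisticToContinuum.FouriersLaw.Theorems.SubdiffusiveBondHeat
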